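import Literature.Geometry.Lorentzian.CarterNearZone
import Literature.Geometry.Lorentzian.CarterFarEnvelope
import HarnessLib

/-!
# One-sided envelopes of the normalised pair of Carter's equation in the flux regime
(namespace `Literature.Geometry.Lorentzian.Kerr`.)

Carter's radial equation `u″ + (ω² − V(ρ x))u = 0` (`V = Kerr.sepPotential M a ω m Λ`, tortoise radius
`ρ`; DRSR arXiv:1402.7034 §5.2.3) in the FLUX REGIME `σ := ω − mω₊ ≠ 0`, `ω ≠ 0`. This file assembles the
zone lemmas (`CarterHorizonZone`, `CarterNearZone`, `CarterFarEnvelope`) into the two ONE-SIDED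
ENVELOPES that the two-point kernel bound (`Literature.Analysis.ODE.kernel_le_of_envelopes_barrier`)
consumes, and records the structure of the classically forbidden set:

* `exists_Icc_eq_of_ordConnected_nonpos` — generic: a continuous `φ`, positive for `s ≤ A` and for
  `s ≥ B`, whose non-positivity set is order-connected, is either positive everywhere or non-positive
  exactly on a compact interval `[b₁, b₂] ⊆ (A, B)` with `φ b₁ = φ b₂ = 0`;
* `carter_coeff_monotoneOn_far` — `ω² − V∘ρ` is non-decreasing on `[x₀, ∞)` once `ρ x₀ ≥ 7M`;
* `carter_etaEnergy_I_le` / `carter_envelope_I` — for the `𝓘⁺`-data solution and a point `Z` to the right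
  of the horizon zone beyond which the coefficient is non-negative: `η²‖u‖² + ‖u′‖² ≤ B_a` on `[Z, x₇]`
  and `‖u s‖² ≤ P_far² + B_a/η²` for all `s ≥ Z`, with
  `P_far = 2 + 2|ω|R_far`, `B_a = (Φ/η²)^16 · exp(2η·(25/κ)·log(2496Λ/(σ²M²))) · (η²P_far² + 2ω²)`;
* `carter_envelope_I_horizonZone` — in the barrier-free case the same solution obeys
  `‖u s‖² ≤ 3^9 B_a/η² + 2·3^8 B_a/σ²` on the horizon zone;
* `carter_envelope_H` — for the `𝓗⁺`-data solution and `b₁` with `ρ b₁ ≤ 7M` before which the coefficient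
  is non-negative: `‖u s‖² ≤ 2·3^9 + H_a/η²` for `s ≤ b₁`,
  `H_a = (Φ/η²)^16 · exp(2η·(25/κ)·log(2496Λ/(σ²M²))) · 3^10σ²`.

All constants are explicit; every factor is later bounded by a power of `Λ/κ` (Λ-polynomial cone
kernel bound of the near-extremal Kerr programme).

## References
* M. Dafermos, I. Rodnianski, Y. Shlapentokh-Rothman, arXiv:1402.7034 = Ann. of Math. 183 (2016),
  §§5.2.3, 6.3, 8 (key `DafermosRodnianskiShlapentokhrothman2014`).
-/

noncomputable section

open Filter Set
open scoped _root_.Topology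

namespace Literature.Geometry.Lorentzian

/-! ### The forbidden set of a continuous coefficient with positive ends -/

/-- **Structure of an order-connected non-positivity set.** Let `φ : ℝ → ℝ` be continuous, positive on
`(−∞, A]` and on `[B, ∞)`, with `{s | φ s ≤ 0}` order-connected. Then either `φ > 0` everywhere, or
`{s | φ s ≤ 0} = [b₁, b₂]` for some `A < b₁ ≤ b₂ < B`, and `φ b₁ = φ b₂ = 0`. [folklore] -/
theorem exists_Icc_eq_of_ordConnected_nonpos {φ : ℝ → ℝ} (hcont : Continuous φ) {A B : ℝ}
    (hA : ∀ s, s ≤ A → 0 < φ s) (hB : ∀ s, B ≤ s → 0 < φ s)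
    (hord : OrdConnected {s | φ s ≤ 0}) :
    (∀ s, 0 < φ s) ∨ ∃ b₁ b₂, A < b₁ ∧ b₁ ≤ b₂ ∧ b₂ < B ∧ {s | φ s ≤ 0} = Icc b₁ b₂ ∧
      φ b₁ = 0 ∧ φ b₂ = 0 := by
  set F := {s | φ s ≤ 0} with hF
  by_cases hne : F.Nonempty
  swap
  · left
    intro s
    by_contra h
    exact hne ⟨s, not_lt.1 h⟩
  right
  have hsub : F ⊆ Icc A B := by
    intro s hs
    refine ⟨le_of_lt (lt_of_not_ge fun h ↦ ?_), le_of_lt (lt_of_not_ge fun h ↦ ?_)⟩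
    · exact absurd hs (not_le.2 (hA s h))
    · exact absurd hs (not_le.2 (hB s h))
  have hclosed : IsClosed F := isClosed_le hcont continuous_const
  have hcpt : IsCompact F := isCompact_Icc.of_isClosed_subset hclosed hsub
  have hbdd_below : BddBelow F := hcpt.bddBelow
  have hbdd_above : BddAbove F := hcpt.bddAbove
  set b₁ := sInf F with hb₁
  set b₂ := sSup F with hb₂
  have hb₁F : b₁ ∈ F := hcpt.sInf_mem hne
  have hb₂F : b₂ ∈ F := hcpt.sSup_mem hne
  have hFeq : F = Icc b₁ b₂ := by
    apply Subset.antisymm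
    · intro s hs; exact ⟨csInf_le hbdd_below hs, le_csSup hbdd_above hs⟩
    · exact hord.out hb₁F hb₂F
  have hAb₁ : A < b₁ := lt_of_not_ge fun h ↦ absurd hb₁F (not_le.2 (hA b₁ h))
  have hb₂B : b₂ < B := lt_of_not_ge fun h ↦ absurd hb₂F (not_le.2 (hB b₂ h))
  have hb : b₁ ≤ b₂ := csInf_le hbdd_below hb₂F
  -- the end values vanish (continuity)
  have hzero : ∀ b ∈ F, (∀ s ∈ F, s ≤ b) ∨ (∀ s ∈ F, b ≤ s) → φ b = 0 := by
    intro b hbF hext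
    rcases (show φ b ≤ 0 from hbF).eq_or_lt with h | h
    · exact h
    · exfalso
      have hev : ∀ᶠ s in 𝓝 b, φ s < 0 := hcont.continuousAt.eventually (gt_mem_nhds h)
      rcases hext with hmax | hmin
      · obtain ⟨s, hs, hsb⟩ := ((hev.filter_mono nhdsWithin_le_nhds).and
          (self_mem_nhdsWithin (s := Ioi b))).exists
        exact absurd (hmax s hs.le) (not_le.2 hsb)
      · obtain ⟨s, hs, hsb⟩ := ((hev.filter_mono nhdsWithin_le_nhds).and
          (self_mem_nhdsWithin (s := Iio b))).exists
        exact absurd (hmin s hs.le) (not_le.2 hsb)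
  refine ⟨b₁, b₂, hAb₁, hb, hb₂B, hFeq, hzero b₁ hb₁F (Or.inr fun s hs ↦ csInf_le hbdd_below hs),
    hzero b₂ hb₂F (Or.inl fun s hs ↦ le_csSup hbdd_above hs)⟩

namespace Kerr

section Envelopes

variable {M a ω Λ : ℝ} {m : ℤ} {ρ : ℝ → ℝ} {u u₁ : ℝ → ℂ}

/-- `ω² − V ∘ ρ` is non-decreasing on `[x₀, ∞)` when `ρ x₀ ≥ 7M` (`dV/dr < 0` there, `dρ/dx > 0`).
[cite: DafermosRodnianskiShlapentokhrothman2014, Prop. 8.4.1 (proof)] -/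
theorem carter_coeff_monotoneOn_far (hρ : IsTortoiseRadius M a ρ) (hMa : IsSubextremal M a)
    (hadm : IsAdmissibleTriple a ω m Λ) {x₀ : ℝ} (hx₀ : 7 * M ≤ ρ x₀) :
    MonotoneOn (fun y ↦ ω ^ 2 - sepPotential M a ω m Λ (ρ y)) (Ici x₀) := by
  refine monotoneOn_of_hasDerivWithinAt_nonneg (convex_Ici x₀)
    (fun y _ ↦ (hρ.hasDerivAt_omega_sq_sub_sepPotential hMa ω m Λ y).continuousAt.continuousWithinAt)
    (fun y _ ↦ (hρ.hasDerivAt_omega_sq_sub_sepPotential hMa ω m Λ y).hasDerivWithinAt) fun y hy ↦ ?_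
  have hy' : x₀ ≤ y := interior_subset (s := Ici x₀) hy
  have h7 : 7 * M ≤ ρ y := hx₀.trans ((hρ.strictMono hMa).monotone hy')
  have hV : deriv (sepPotential M a ω m Λ) (ρ y) < 0 := deriv_sepPotential_neg_of_seven_mul_le hMa hadm h7
  have hρ' : 0 < delta M a (ρ y) / (ρ y ^ 2 + a ^ 2) := hρ.deriv_pos hMa y
  nlinarith [mul_neg_of_neg_of_pos hV hρ']

/-- **`η`-energy of the `𝓘⁺`-data solution on a near zone `[Z, x₇]`.** Let `ρ x₇ = 7M`, `Z < x₇` with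
`ρ Z ≥ r₊ + σ²M³/(416Λ)` (`σ = ω − mω₊ ≠ 0`, `ω ≠ 0`, `Λ ≥ 1`), `0 < η`, `η² ≤ Φ`, `ω² − V∘ρ ≤ Φ`
everywhere and `ω² − V∘ρ ≥ 0` on `[Z, ∞)`. Then for `s ∈ [Z, x₇]`:
`η²‖u s‖² + ‖u′ s‖² ≤ (Φ/η²)^16 · exp(2η·(25/κ)log(2496Λ/(σ²M²))) · (η²(2 + 2|ω|R)² + 2ω²)`,
`R = max(7M, √(12Λ)/|ω|, 1/(Mω²))`. [folklore] -/
theorem carter_etaEnergy_I_le (hρ : IsTortoiseRadius M a ρ) (hMa : IsSubextremal M a)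
    (hadm : IsAdmissibleTriple a ω m Λ) (hΛ : 1 ≤ Λ) (hσ : ω - m * horizonAngularVelocity M a ≠ 0)
    (hω : ω ≠ 0)
    (hu : ∀ x, HasDerivAt u (u₁ x) x ∧
      HasDerivAt u₁ (-(((ω ^ 2 - sepPotential M a ω m Λ (ρ x) : ℝ) : ℂ) * u x)) x)
    (hlim : Tendsto (fun x ↦ ‖u x‖) atTop (𝓝 1)) (hlim₁ : Tendsto (fun x ↦ ‖u₁ x‖) atTop (𝓝 |ω|))
    {Z x₇ η Φ : ℝ} (hx₇ : ρ x₇ = 7 * M) (hZx₇ : Z < x₇)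
    (hZ : rPlus M a + (ω - m * horizonAngularVelocity M a) ^ 2 * M ^ 3 / (416 * Λ) ≤ ρ Z)
    (hη : 0 < η) (hηΦ : η ^ 2 ≤ Φ) (hΦ : ∀ s, ω ^ 2 - sepPotential M a ω m Λ (ρ s) ≤ Φ)
    (hpos : ∀ s, Z ≤ s → 0 ≤ ω ^ 2 - sepPotential M a ω m Λ (ρ s)) {s : ℝ} (hs : s ∈ Icc Z x₇) :
    η ^ 2 * ‖u s‖ ^ 2 + ‖u₁ s‖ ^ 2 ≤
      (Φ / η ^ 2) ^ 16 *
        Real.exp (2 * η * (25 / surfaceGravity M a *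
          Real.log (2496 * Λ / ((ω - m * horizonAngularVelocity M a) ^ 2 * M ^ 2)))) *
        (η ^ 2 * (2 + 2 * |ω| * max (7 * M) (max (Real.sqrt (12 * Λ) / |ω|) (1 / (M * ω ^ 2)))) ^ 2 +
          2 * ω ^ 2) := by
  set σ := ω - m * horizonAngularVelocity M a with hσdef
  set R := max (7 * M) (max (Real.sqrt (12 * Λ) / |ω|) (1 / (M * ω ^ 2))) with hR
  have hx₇' : 7 * M ≤ ρ x₇ := hx₇.ge
  -- data at `x₇`
  have hfar : ‖u x₇‖ ≤ 2 + 2 * |ω| * R :=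
    carter_far_norm_le hρ hMa hω hadm hu hlim hlim₁ hx₇' (fun t ht ↦ hpos t (hZx₇.le.trans ht))
  have hder : ‖u₁ x₇‖ ≤ Real.sqrt 2 * |ω| :=
    carter_far_norm_deriv_le hρ hMa hadm hu hlim hlim₁ hx₇' (hpos x₇ hZx₇.le)
  have hE7 : η ^ 2 * ‖u x₇‖ ^ 2 + ‖u₁ x₇‖ ^ 2 ≤ η ^ 2 * (2 + 2 * |ω| * R) ^ 2 + 2 * ω ^ 2 := by
    have h1 : ‖u x₇‖ ^ 2 ≤ (2 + 2 * |ω| * R) ^ 2 := pow_le_pow_left₀ (norm_nonneg _) hfar 2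
    have h2 : ‖u₁ x₇‖ ^ 2 ≤ (Real.sqrt 2 * |ω|) ^ 2 := pow_le_pow_left₀ (norm_nonneg _) hder 2
    have e : (Real.sqrt 2 * |ω|) ^ 2 = 2 * ω ^ 2 := by
      rw [mul_pow, Real.sq_sqrt (by norm_num : (0 : ℝ) ≤ 2), sq_abs]
    rw [e] at h2
    nlinarith [sq_nonneg η]
  -- transport on `[Z, x₇]`
  have hzone : ∀ t ∈ Icc Z x₇, -η ^ 2 ≤ ω ^ 2 - sepPotential M a ω m Λ (ρ t) ∧
      ω ^ 2 - sepPotential M a ω m Λ (ρ t) ≤ Φ := fun t ht ↦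
    ⟨le_trans (by nlinarith [sq_nonneg η]) (hpos t ht.1), hΦ t⟩
  have key := carter_tameZone_transport hρ hMa hadm hu hZx₇ hη hηΦ hzone (x := x₇) (y := s)
    (right_mem_Icc.2 hZx₇.le) hs
  have hlen : x₇ - Z ≤ 25 / surfaceGravity M a * Real.log (2496 * Λ / (σ ^ 2 * M ^ 2)) :=
    hρ.tameZone_length_le hMa hσ hΛ hZ hZx₇.le (by rw [hx₇])
  have hexp : Real.exp (2 * η * (x₇ - Z)) ≤
      Real.exp (2 * η * (25 / surfaceGravity M a * Real.log (2496 * Λ / (σ ^ 2 * M ^ 2)))) :=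
    Real.exp_le_exp.2 (mul_le_mul_of_nonneg_left hlen (by positivity))
  calc η ^ 2 * ‖u s‖ ^ 2 + ‖u₁ s‖ ^ 2
      ≤ (Φ / η ^ 2) ^ 16 * Real.exp (2 * η * (x₇ - Z)) * (η ^ 2 * ‖u x₇‖ ^ 2 + ‖u₁ x₇‖ ^ 2) := key
    _ ≤ (Φ / η ^ 2) ^ 16 *
        Real.exp (2 * η * (25 / surfaceGravity M a * Real.log (2496 * Λ / (σ ^ 2 * M ^ 2)))) *
        (η ^ 2 * (2 + 2 * |ω| * R) ^ 2 + 2 * ω ^ 2) := by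
        have h0 : 0 ≤ (Φ / η ^ 2) ^ 16 := by
          have : 0 ≤ Φ / η ^ 2 := div_nonneg ((sq_nonneg η).trans hηΦ) (sq_nonneg η)
          positivity
        gcongr

/-- **Envelope of the `𝓘⁺`-data solution beyond `Z`** (far zone by the far envelope, near zone by
`carter_etaEnergy_I_le`): for all `s ≥ Z`,
`‖u s‖² ≤ (2 + 2|ω|R)² + B_a/η²`. Hypotheses as in `carter_etaEnergy_I_le` (with `Z ≤ x₇` allowed to
fail: then only the far zone occurs). [folklore] -/
theorem carter_envelope_I (hρ : IsTortoiseRadius M a ρ) (hMa : IsSubextremal M a)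
    (hadm : IsAdmissibleTriple a ω m Λ) (hΛ : 1 ≤ Λ) (hσ : ω - m * horizonAngularVelocity M a ≠ 0)
    (hω : ω ≠ 0)
    (hu : ∀ x, HasDerivAt u (u₁ x) x ∧
      HasDerivAt u₁ (-(((ω ^ 2 - sepPotential M a ω m Λ (ρ x) : ℝ) : ℂ) * u x)) x)
    (hlim : Tendsto (fun x ↦ ‖u x‖) atTop (𝓝 1)) (hlim₁ : Tendsto (fun x ↦ ‖u₁ x‖) atTop (𝓝 |ω|))
    {Z x₇ η Φ : ℝ} (hx₇ : ρ x₇ = 7 * M)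
    (hZ : rPlus M a + (ω - m * horizonAngularVelocity M a) ^ 2 * M ^ 3 / (416 * Λ) ≤ ρ Z)
    (hη : 0 < η) (hηΦ : η ^ 2 ≤ Φ) (hΦ : ∀ s, ω ^ 2 - sepPotential M a ω m Λ (ρ s) ≤ Φ)
    (hpos : ∀ s, Z ≤ s → 0 ≤ ω ^ 2 - sepPotential M a ω m Λ (ρ s)) {s : ℝ} (hs : Z ≤ s) :
    ‖u s‖ ^ 2 ≤
      (2 + 2 * |ω| * max (7 * M) (max (Real.sqrt (12 * Λ) / |ω|) (1 / (M * ω ^ 2)))) ^ 2 +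
      (Φ / η ^ 2) ^ 16 *
        Real.exp (2 * η * (25 / surfaceGravity M a *
          Real.log (2496 * Λ / ((ω - m * horizonAngularVelocity M a) ^ 2 * M ^ 2)))) *
        (η ^ 2 * (2 + 2 * |ω| * max (7 * M) (max (Real.sqrt (12 * Λ) / |ω|) (1 / (M * ω ^ 2)))) ^ 2 +
          2 * ω ^ 2) / η ^ 2 := by
  set R := max (7 * M) (max (Real.sqrt (12 * Λ) / |ω|) (1 / (M * ω ^ 2))) with hR
  set Ba := (Φ / η ^ 2) ^ 16 *
        Real.exp (2 * η * (25 / surfaceGravity M a *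
          Real.log (2496 * Λ / ((ω - m * horizonAngularVelocity M a) ^ 2 * M ^ 2)))) *
        (η ^ 2 * (2 + 2 * |ω| * R) ^ 2 + 2 * ω ^ 2) with hBa
  have hBa0 : 0 ≤ Ba := by
    have : 0 ≤ Φ / η ^ 2 := div_nonneg ((sq_nonneg η).trans hηΦ) (sq_nonneg η)
    positivity
  have hP0 : 0 ≤ (2 + 2 * |ω| * R) ^ 2 := sq_nonneg _
  rcases le_or_gt (7 * M) (ρ s) with h7 | h7
  · -- far zone
    have hfar : ‖u s‖ ≤ 2 + 2 * |ω| * R :=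
      carter_far_norm_le hρ hMa hω hadm hu hlim hlim₁ h7 (fun t ht ↦ hpos t (hs.trans ht))
    have h1 : ‖u s‖ ^ 2 ≤ (2 + 2 * |ω| * R) ^ 2 := pow_le_pow_left₀ (norm_nonneg _) hfar 2
    have h2 : 0 ≤ Ba / η ^ 2 := by positivity
    linarith
  · -- near zone `[Z, x₇]`
    have hsx₇ : s < x₇ := by rw [← hρ.lt_iff_lt hMa, hx₇]; exact h7
    have hZx₇ : Z < x₇ := lt_of_le_of_lt hs hsx₇
    have key := carter_etaEnergy_I_le hρ hMa hadm hΛ hσ hω hu hlim hlim₁ hx₇ hZx₇ hZ hη hηΦ hΦ hpos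
      (s := s) ⟨hs, hsx₇.le⟩
    have hη2 : 0 < η ^ 2 := by positivity
    have h1 : ‖u s‖ ^ 2 ≤ Ba / η ^ 2 := by
      rw [le_div_iff₀ hη2]
      have : η ^ 2 * ‖u s‖ ^ 2 ≤ Ba := le_trans (le_add_of_nonneg_right (sq_nonneg _)) key
      linarith
    linarith

/-- **The `𝓘⁺`-data solution on the horizon zone (barrier-free case).** If `ρ x_a = r₊ + σ²M³/(416Λ)`,
`x_a < x₇`, `ρ x₇ = 7M` and the coefficient is non-negative on `[x_a, ∞)` (it is automatically `≥ σ²/2`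
below `x_a`), then for `s ≤ x_a`: `‖u s‖² ≤ 3^9 B_a/η² + 2·3^8 B_a/σ²`. [folklore] -/
theorem carter_envelope_I_horizonZone (hρ : IsTortoiseRadius M a ρ) (hMa : IsSubextremal M a)
    (hadm : IsAdmissibleTriple a ω m Λ) (hΛ : 1 ≤ Λ) (hσ : ω - m * horizonAngularVelocity M a ≠ 0)
    (hω : ω ≠ 0)
    (hu : ∀ x, HasDerivAt u (u₁ x) x ∧
      HasDerivAt u₁ (-(((ω ^ 2 - sepPotential M a ω m Λ (ρ x) : ℝ) : ℂ) * u x)) x)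
    (hlim : Tendsto (fun x ↦ ‖u x‖) atTop (𝓝 1)) (hlim₁ : Tendsto (fun x ↦ ‖u₁ x‖) atTop (𝓝 |ω|))
    {xa x₇ η Φ : ℝ} (hx₇ : ρ x₇ = 7 * M) (hxax₇ : xa < x₇)
    (hxa : ρ xa = rPlus M a + (ω - m * horizonAngularVelocity M a) ^ 2 * M ^ 3 / (416 * Λ))
    (hη : 0 < η) (hηΦ : η ^ 2 ≤ Φ) (hΦ : ∀ s, ω ^ 2 - sepPotential M a ω m Λ (ρ s) ≤ Φ)
    (hpos : ∀ s, xa ≤ s → 0 ≤ ω ^ 2 - sepPotential M a ω m Λ (ρ s)) {s : ℝ} (hs : s ≤ xa) :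
    ‖u s‖ ^ 2 ≤
      3 ^ 9 * ((Φ / η ^ 2) ^ 16 *
        Real.exp (2 * η * (25 / surfaceGravity M a *
          Real.log (2496 * Λ / ((ω - m * horizonAngularVelocity M a) ^ 2 * M ^ 2)))) *
        (η ^ 2 * (2 + 2 * |ω| * max (7 * M) (max (Real.sqrt (12 * Λ) / |ω|) (1 / (M * ω ^ 2)))) ^ 2 +
          2 * ω ^ 2)) / η ^ 2 +
      2 * 3 ^ 8 * ((Φ / η ^ 2) ^ 16 *
        Real.exp (2 * η * (25 / surfaceGravity M a *
          Real.log (2496 * Λ / ((ω - m * horizonAngularVelocity M a) ^ 2 * M ^ 2)))) *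
        (η ^ 2 * (2 + 2 * |ω| * max (7 * M) (max (Real.sqrt (12 * Λ) / |ω|) (1 / (M * ω ^ 2)))) ^ 2 +
          2 * ω ^ 2)) / (ω - m * horizonAngularVelocity M a) ^ 2 := by
  set σ := ω - m * horizonAngularVelocity M a with hσdef
  set R := max (7 * M) (max (Real.sqrt (12 * Λ) / |ω|) (1 / (M * ω ^ 2))) with hR
  set Ba := (Φ / η ^ 2) ^ 16 *
        Real.exp (2 * η * (25 / surfaceGravity M a * Real.log (2496 * Λ / (σ ^ 2 * M ^ 2)))) *
        (η ^ 2 * (2 + 2 * |ω| * R) ^ 2 + 2 * ω ^ 2) with hBa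
  have hσ2 : 0 < σ ^ 2 := by positivity
  have hη2 : 0 < η ^ 2 := by positivity
  have hBa0 : 0 ≤ Ba := by
    have : 0 ≤ Φ / η ^ 2 := div_nonneg ((sq_nonneg η).trans hηΦ) (sq_nonneg η)
    positivity
  -- `η`-energy at `xa` from the near-zone transport
  have hE := carter_etaEnergy_I_le hρ hMa hadm hΛ hσ hω hu hlim hlim₁ hx₇ hxax₇ hxa.ge hη hηΦ hΦ hpos
    (s := xa) (left_mem_Icc.2 hxax₇.le)
  have hg : ‖u xa‖ ^ 2 ≤ Ba / η ^ 2 := by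
    rw [le_div_iff₀ hη2]
    have : η ^ 2 * ‖u xa‖ ^ 2 ≤ Ba := le_trans (le_add_of_nonneg_right (sq_nonneg _)) hE
    linarith
  have hg₁ : ‖u₁ xa‖ ^ 2 ≤ Ba := le_trans (le_add_of_nonneg_left (by positivity)) hE
  -- horizon zone: Sonin ratio `3^8` between `xa` and `s`
  have hxa' : ρ xa - rPlus M a ≤ σ ^ 2 * M ^ 3 / (416 * Λ) := by rw [hxa]; ring_nf; exact le_rfl
  have hs' : ρ s - rPlus M a ≤ σ ^ 2 * M ^ 3 / (416 * Λ) := by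
    have := (hρ.strictMono hMa).monotone hs; linarith
  have hT := carter_horizonZone_energy_le_of_data hρ hMa hadm hΛ hσ hu hxa' hs'
  have hφa := (coeff_mem_Icc_of_horizonZone hρ hMa hadm hΛ hxa').2
  have hφs := (coeff_mem_Icc_of_horizonZone hρ hMa hadm hΛ hs').1
  -- `T(xa) ≤ (3σ²/2)(Ba/η²) + Ba`
  have hTa : (ω ^ 2 - sepPotential M a ω m Λ (ρ xa)) * ‖u xa‖ ^ 2 + ‖u₁ xa‖ ^ 2 ≤
      3 * σ ^ 2 / 2 * (Ba / η ^ 2) + Ba := by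
    have h1 : (ω ^ 2 - sepPotential M a ω m Λ (ρ xa)) * ‖u xa‖ ^ 2 ≤ 3 * σ ^ 2 / 2 * (Ba / η ^ 2) :=
      mul_le_mul hφa hg (sq_nonneg _) (by positivity)
    linarith
  -- `(σ²/2) g(s) ≤ T(s) ≤ 3^8 T(xa)`
  have hgs : σ ^ 2 / 2 * ‖u s‖ ^ 2 ≤ 3 ^ 8 * (3 * σ ^ 2 / 2 * (Ba / η ^ 2) + Ba) := by
    calc σ ^ 2 / 2 * ‖u s‖ ^ 2 ≤ (ω ^ 2 - sepPotential M a ω m Λ (ρ s)) * ‖u s‖ ^ 2 + ‖u₁ s‖ ^ 2 := by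
          nlinarith [mul_le_mul_of_nonneg_right hφs (sq_nonneg ‖u s‖), sq_nonneg ‖u₁ s‖]
      _ ≤ _ := hT
      _ ≤ 3 ^ 8 * (3 * σ ^ 2 / 2 * (Ba / η ^ 2) + Ba) := by gcongr
  have : ‖u s‖ ^ 2 ≤ 2 / σ ^ 2 * (3 ^ 8 * (3 * σ ^ 2 / 2 * (Ba / η ^ 2) + Ba)) := by
    rw [div_mul_eq_mul_div, le_div_iff₀ hσ2]
    linarith
  calc ‖u s‖ ^ 2 ≤ 2 / σ ^ 2 * (3 ^ 8 * (3 * σ ^ 2 / 2 * (Ba / η ^ 2) + Ba)) := this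
    _ = 3 ^ 9 * Ba / η ^ 2 + 2 * 3 ^ 8 * Ba / σ ^ 2 := by field_simp

/-- **Envelope of the `𝓗⁺`-data solution before `b₁`.** Let `ρ x_a = r₊ + σ²M³/(416Λ)`,
`ρ b₁ ≤ 7M`, `0 < η`, `η² ≤ σ²/4`, `η² ≤ Φ`, `ω² − V∘ρ ≤ Φ` everywhere and `≥ 0` on `(−∞, b₁]`. Then for
`s ≤ b₁`: `‖u s‖² ≤ 2·3^9 + H_a/η²`, `H_a = (Φ/η²)^16 · exp(2η·(25/κ)log(2496Λ/(σ²M²))) · 3^10σ²`. [folklore] -/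
theorem carter_envelope_H (hρ : IsTortoiseRadius M a ρ) (hMa : IsSubextremal M a)
    (hadm : IsAdmissibleTriple a ω m Λ) (hΛ : 1 ≤ Λ) (hσ : ω - m * horizonAngularVelocity M a ≠ 0)
    (hu : ∀ x, HasDerivAt u (u₁ x) x ∧
      HasDerivAt u₁ (-(((ω ^ 2 - sepPotential M a ω m Λ (ρ x) : ℝ) : ℂ) * u x)) x)
    (hlim : Tendsto (fun x ↦ ‖u x‖) atBot (𝓝 1))
    (hlim₁ : Tendsto (fun x ↦ ‖u₁ x‖) atBot (𝓝 |ω - m * horizonAngularVelocity M a|))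
    {xa b₁ η Φ : ℝ}
    (hxa : ρ xa = rPlus M a + (ω - m * horizonAngularVelocity M a) ^ 2 * M ^ 3 / (416 * Λ))
    (hb₁7 : ρ b₁ ≤ 7 * M) (hη : 0 < η)
    (hησ : η ^ 2 ≤ (ω - m * horizonAngularVelocity M a) ^ 2 / 4) (hηΦ : η ^ 2 ≤ Φ)
    (hΦ : ∀ s, ω ^ 2 - sepPotential M a ω m Λ (ρ s) ≤ Φ)
    (hpos : ∀ s, s ≤ b₁ → 0 ≤ ω ^ 2 - sepPotential M a ω m Λ (ρ s)) {s : ℝ} (hs : s ≤ b₁) :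
    ‖u s‖ ^ 2 ≤ 2 * 3 ^ 9 +
      (Φ / η ^ 2) ^ 16 *
        Real.exp (2 * η * (25 / surfaceGravity M a *
          Real.log (2496 * Λ / ((ω - m * horizonAngularVelocity M a) ^ 2 * M ^ 2)))) *
        (3 ^ 10 * (ω - m * horizonAngularVelocity M a) ^ 2) / η ^ 2 := by
  set σ := ω - m * horizonAngularVelocity M a with hσdef
  set Ha := (Φ / η ^ 2) ^ 16 *
        Real.exp (2 * η * (25 / surfaceGravity M a * Real.log (2496 * Λ / (σ ^ 2 * M ^ 2)))) *
        (3 ^ 10 * σ ^ 2) with hHa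
  have hσ2 : 0 < σ ^ 2 := by positivity
  have hη2 : 0 < η ^ 2 := by positivity
  have hT0 : 0 ≤ (Φ / η ^ 2) ^ 16 := by
    have : 0 ≤ Φ / η ^ 2 := div_nonneg ((sq_nonneg η).trans hηΦ) (sq_nonneg η)
    positivity
  have hHa0 : 0 ≤ Ha := by positivity
  have hxa' : ρ xa - rPlus M a ≤ σ ^ 2 * M ^ 3 / (416 * Λ) := by rw [hxa]; ring_nf; exact le_rfl
  -- horizon zone bound at any point left of `xa`, and the `η`-energy at `xa`
  have hzone : ∀ t, t ≤ xa → ‖u t‖ ^ 2 ≤ 2 * 3 ^ 9 ∧ ‖u₁ t‖ ^ 2 ≤ 3 ^ 9 * σ ^ 2 := by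
    intro t ht
    have ht' : ρ t - rPlus M a ≤ σ ^ 2 * M ^ 3 / (416 * Λ) := by
      have := (hρ.strictMono hMa).monotone ht; linarith
    exact carter_horizonZone_norm_sq_le hρ hMa hadm hΛ hσ hu hlim hlim₁ ht'
  rcases le_or_gt s xa with hsa | hsa
  · have h1 := (hzone s hsa).1
    have h2 : 0 ≤ Ha / η ^ 2 := by positivity
    linarith
  · -- transport on `[xa, b₁]` from `xa`
    have hxab : xa < b₁ := hsa.trans_le hs
    have hEa : η ^ 2 * ‖u xa‖ ^ 2 + ‖u₁ xa‖ ^ 2 ≤ 3 ^ 10 * σ ^ 2 := by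
      obtain ⟨h1, h2⟩ := hzone xa le_rfl
      nlinarith [mul_le_mul hησ h1 (sq_nonneg _) (by positivity)]
    have hz : ∀ t ∈ Icc xa b₁, -η ^ 2 ≤ ω ^ 2 - sepPotential M a ω m Λ (ρ t) ∧
        ω ^ 2 - sepPotential M a ω m Λ (ρ t) ≤ Φ := fun t ht ↦
      ⟨le_trans (by nlinarith [sq_nonneg η]) (hpos t ht.2), hΦ t⟩
    have key := carter_tameZone_transport hρ hMa hadm hu hxab hη hηΦ hz (x := xa) (y := s)
      (left_mem_Icc.2 hxab.le) ⟨hsa.le, hs⟩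
    have hlen : b₁ - xa ≤ 25 / surfaceGravity M a * Real.log (2496 * Λ / (σ ^ 2 * M ^ 2)) :=
      hρ.tameZone_length_le hMa hσ hΛ hxa.ge hxab.le hb₁7
    have hexp : Real.exp (2 * η * (b₁ - xa)) ≤
        Real.exp (2 * η * (25 / surfaceGravity M a * Real.log (2496 * Λ / (σ ^ 2 * M ^ 2)))) :=
      Real.exp_le_exp.2 (mul_le_mul_of_nonneg_left hlen (by positivity))
    have hEs : η ^ 2 * ‖u s‖ ^ 2 + ‖u₁ s‖ ^ 2 ≤ Ha := by
      calc η ^ 2 * ‖u s‖ ^ 2 + ‖u₁ s‖ ^ 2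
          ≤ (Φ / η ^ 2) ^ 16 * Real.exp (2 * η * (b₁ - xa)) * (η ^ 2 * ‖u xa‖ ^ 2 + ‖u₁ xa‖ ^ 2) := key
        _ ≤ (Φ / η ^ 2) ^ 16 *
            Real.exp (2 * η * (25 / surfaceGravity M a * Real.log (2496 * Λ / (σ ^ 2 * M ^ 2)))) *
            (3 ^ 10 * σ ^ 2) := by gcongr
    have h1 : ‖u s‖ ^ 2 ≤ Ha / η ^ 2 := by
      rw [le_div_iff₀ hη2]
      have : η ^ 2 * ‖u s‖ ^ 2 ≤ Ha := le_trans (le_add_of_nonneg_right (sq_nonneg _)) hEs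
      linarith
    linarith

end Envelopes

end Kerr

end Literature.Geometry.Lorentzian

end
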